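import Summits.PneNP.PneNP.Theorems.ChebyshevTracialDesignHighPassInvisible
import Summits.PneNP.PneNP.Theorems.ChebyshevTracialDesignBlockDecomposition
import HarnessLib

/-!
# Cell pnp-psdrank, route `ChebyshevTracialDesign`: L¹-FROBENIUS SLACK on either side, and the SIGN cell in its final modular form
# «low-degree Gram representative + high-pass field + Frobenius-small field» (crux `TracialDecayExp20`, stmt-PneNP-19878)

Brick 97 (prover g18; MEMO-21 §2(d), §5(1)). Brick 88 §5 (`…BlockDecomposition.abs_value_le_of_opNorm`) prices an additive error `E` in OPERATOR
norm (`−ηI ⪯ E_U ⪯ ηI` for every cut: `|value(E,Y)| ≤ (Σ|w_c|)·η·r`). The representatives of MEMO-21's rule (`X^{≤D} = X'^{≤D} +` small) come with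
errors that are small only in Frobenius norm ON AVERAGE over the cuts (truncations of random or symmetric masks), so the slack cell is restated in
that currency — it is elementary (row/column sums of `|W|` are uniform, brick 88 `rowSum_absWeight_le` / `colSum_absWeight_le`) and needs no
positivity of `E`:
* §1 `abs_trace_mul_le_frobenius` (`|tr(E Y)| ≤ ‖E‖_F‖Y‖_F`); **`abs_value_le_frobenius_avg`** — for ANY cut field `E`, ANY matching field `Y` with
  `‖Y_M‖_F ≤ ρ`: `|value(E,Y)| ≤ (Σ_c|w_c|)·ρ·(Σ_{|U|=t}‖E_U‖_F)/#{t-cuts}`; for psd contractions `Y` take `ρ = √r` (`abs_value_le_frobenius_avg_contraction`);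
  **`abs_value_le_frobenius_avg_matchingSide`** — the mirror statement (`Σ_M ‖E_M‖_F/|PM|` against `‖X_U‖_F ≤ ρ`).
* §2 **`value_le_of_sign_highPass_frobenius`** — THE SIGN CELL, MODULAR FORM: for an exact design `(n, t = 2c'+1, T, D ≤ 2c', B_v, C, w)`,
  `D ≤ k ≤ c'`, a psd-contraction `Y`, and a cut field `X = A Aᵀ + H + E` with `A` of Johnson degree `≤ k`, `A Aᵀ ⪯ I`, `H` HIGH-PASS (harmonic datum
  vanishing up to degree `D`, Frobenius mass `N_H`), `E` arbitrary:
  `value(X,Y) ≤ r·(B_v√P_D + 2^{k+1}√P_k + Σ_{κ∈(D/2,k/2]} R_κ√A_κ) + B_v·√(P_D·(N_H/C(n,t))·r) + B_v·√r·avg_{|U|=t}‖E_U‖_F`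
  (bricks 94b + 95 + §1). `X` itself need not be psd, low-degree, or a contraction; all three defects are charged separately and additively.
[cite: Rothvoss2017, §2 (PDF p. 6)] [cite: Grigoriev2001, Lemma 1.4 (PDF p. 8)] [cite: GriblingDelaatLaurent2019, §5]
Stature: support/instrument (kernel lane, no defs, axioms standard). WHAT THIS IS NOT: no statement about which fields admit such a representation,
no proof or refutation of `TracialDecayExp20`, nothing on psd rank of P_PM(K_n), no P-vs-NP content. Supports stmt-PneNP-19878.
-/

set_option linter.dupNamespace false -- `Summit.PneNP.PneNP.…`: summit = sub-problem (D-0017)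

noncomputable section

namespace Summit.PneNP.PneNP.Theorems.ChebyshevTracialDesignFrobeniusSlack

open Finset Matrix Literature.Barriers.PneNP Literature.Combinatorics.Optimization
open Literature.Combinatorics.AssociationSchemes Literature.Combinatorics.AssociationSchemes.JohnsonHarmonics
open Summit.PneNP.PneNP.Theorems.ChebyshevTracialDesignBoundedDim (absWeight absWeight_nonneg)
open Summit.PneNP.PneNP.Theorems.ChebyshevTracialDesignFreeBinning (abs_levelWeight_le_absWeight)
open Summit.PneNP.PneNP.Theorems.ChebyshevTracialDesignBlockDecomposition (rowSum_absWeight_le colSum_absWeight_le value_add_left)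
open Summit.PneNP.PneNP.Theorems.ChebyshevTracialDesignTracialProfilePolynomial (frobenius_sq_le)
open Summit.PneNP.PneNP.Theorems.ChebyshevTracialDesignHighPassInvisible (abs_value_le_of_highPass)
open Summit.PneNP.PneNP.Theorems.ChebyshevTracialDesignExtendedSignSharp (value_le_of_lowDegree_allModes_sharp)
open scoped MatrixOrder

variable {n r : ℕ}

/-! ### §1 The L¹-Frobenius slack cells -/

/-- **`|tr(E Y)| ≤ ‖E‖_F · ‖Y‖_F`** (Cauchy–Schwarz on the entries). [cite: HornJohnson2012, Thm. 5.6.2 / (5.6.0.2) (Frobenius norm, Cauchy–Schwarz)] -/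
theorem abs_trace_mul_le_frobenius (E Y : Matrix (Fin r) (Fin r) ℝ) :
    |(E * Y).trace| ≤ Real.sqrt (∑ a, ∑ b, E a b ^ 2) * Real.sqrt (∑ a, ∑ b, Y a b ^ 2) := by
  have htr : (E * Y).trace = ∑ ab : Fin r × Fin r, E ab.1 ab.2 * Y ab.2 ab.1 := by
    rw [← univ_product_univ, sum_product]; simp only [Matrix.trace, Matrix.diag_apply, Matrix.mul_apply]
  have hcs := Finset.sum_mul_sq_le_sq_mul_sq (univ : Finset (Fin r × Fin r)) (fun ab => E ab.1 ab.2) (fun ab => Y ab.2 ab.1)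
  have hE : ∑ ab : Fin r × Fin r, E ab.1 ab.2 ^ 2 = ∑ a, ∑ b, E a b ^ 2 := by rw [← univ_product_univ, sum_product]
  have hY : ∑ ab : Fin r × Fin r, Y ab.2 ab.1 ^ 2 = ∑ a, ∑ b, Y a b ^ 2 := by
    rw [← univ_product_univ, sum_product, sum_comm]
  rw [hE, hY] at hcs
  rw [htr, ← Real.sqrt_mul (sum_nonneg fun a _ => sum_nonneg fun b _ => sq_nonneg _), ← Real.sqrt_sq_eq_abs]
  exact Real.sqrt_le_sqrt hcs

/-- `absWeight` vanishes off the `t`-cuts. [cite: Rothvoss2017, §2 (PDF p. 6)] -/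
theorem absWeight_eq_zero_of_card_ne {t : ℕ} (C : Finset ℕ) (w : ℕ → ℝ) {U : OddSet n} (hU : U.1.card ≠ t) (M : PMatch n) :
    absWeight n t C w U M = 0 := by
  unfold absWeight
  refine sum_eq_zero fun c _ => ?_
  rw [if_neg]
  intro h
  exact hU (mem_Qset_iff.1 h).1

/-- **L¹-FROBENIUS SLACK (cut side).** For ANY cut field `E` and ANY matching field `Y` with `‖Y_M‖_F ≤ ρ` for all `M`:
`|Σ_{U,M} W(U,M)·tr(E_U Y_M)| ≤ (Σ_c|w_c|)·ρ·(Σ_{|U|=t} ‖E_U‖_F)/#{t-cuts}` — an error that is small in Frobenius norm ON AVERAGE over the cuts is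
priced at that average; no sign or degree hypothesis on `E`. [cite: Rothvoss2017, §2 (PDF p. 6)] -/
theorem abs_value_le_frobenius_avg (t : ℕ) (C : Finset ℕ) (w : ℕ → ℝ) {ρ : ℝ} (hρ : 0 ≤ ρ)
    (E : OddSet n → Matrix (Fin r) (Fin r) ℝ) (Y : PMatch n → Matrix (Fin r) (Fin r) ℝ)
    (hY : ∀ M, Real.sqrt (∑ a, ∑ b, Y M a b ^ 2) ≤ ρ) :
    |∑ U, ∑ M, levelWeight n t C w U M * (E U * Y M).trace| ≤
      (∑ c ∈ C, |w c|) * ρ *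
        ((∑ U : OddSet n, if U.1.card = t then Real.sqrt (∑ a, ∑ b, E U a b ^ 2) else 0) /
          ((univ.filter fun U : OddSet n => U.1.card = t).card : ℝ)) := by
  set nF : OddSet n → ℝ := fun U => Real.sqrt (∑ a, ∑ b, E U a b ^ 2) with hnF
  have hEY : ∀ U M, |(E U * Y M).trace| ≤ nF U * ρ := fun U M =>
    (abs_trace_mul_le_frobenius (E U) (Y M)).trans (mul_le_mul_of_nonneg_left (hY M) (Real.sqrt_nonneg _))
  set Tc : ℝ := ((univ.filter fun U : OddSet n => U.1.card = t).card : ℝ) with hTc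
  have hBv0 : 0 ≤ ∑ c ∈ C, |w c| := sum_nonneg fun c _ => abs_nonneg _
  calc |∑ U, ∑ M, levelWeight n t C w U M * (E U * Y M).trace|
      ≤ ∑ U, |∑ M, levelWeight n t C w U M * (E U * Y M).trace| := abs_sum_le_sum_abs _ _
    _ ≤ ∑ U, ∑ M, |levelWeight n t C w U M * (E U * Y M).trace| := sum_le_sum fun U _ => abs_sum_le_sum_abs _ _
    _ ≤ ∑ U, ∑ M, absWeight n t C w U M * (nF U * ρ) := by
        refine sum_le_sum fun U _ => sum_le_sum fun M _ => ?_
        rw [abs_mul]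
        exact mul_le_mul (abs_levelWeight_le_absWeight t C w U M) (hEY U M) (abs_nonneg _) (absWeight_nonneg t C w U M)
    _ = ∑ U, (∑ M, absWeight n t C w U M) * (nF U * ρ) := sum_congr rfl fun U _ => by rw [sum_mul]
    _ ≤ ∑ U : OddSet n, (if U.1.card = t then (∑ c ∈ C, |w c|) / Tc * (nF U * ρ) else 0) := by
        refine sum_le_sum fun U _ => ?_
        split_ifs with hU
        · exact mul_le_mul_of_nonneg_right (rowSum_absWeight_le t C w U) (mul_nonneg (Real.sqrt_nonneg _) hρ)
        · rw [sum_eq_zero fun M _ => absWeight_eq_zero_of_card_ne C w hU M, zero_mul]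
    _ = (∑ c ∈ C, |w c|) * ρ * ((∑ U : OddSet n, if U.1.card = t then nF U else 0) / Tc) := by
        have key : ∀ U : OddSet n, (if U.1.card = t then (∑ c ∈ C, |w c|) / Tc * (nF U * ρ) else 0) =
            (∑ c ∈ C, |w c|) * ρ * ((if U.1.card = t then nF U else 0) / Tc) := by
          intro U; split_ifs <;> ring
        simp_rw [key]
        rw [← Finset.mul_sum, ← Finset.sum_div]

/-- **L¹-Frobenius slack against psd contractions** (`‖Y_M‖_F ≤ √r`): `|value(E,Y)| ≤ (Σ|w_c|)·√r·avg_{|U|=t}‖E_U‖_F`.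
[cite: Rothvoss2017, §2 (PDF p. 6)] -/
theorem abs_value_le_frobenius_avg_contraction (t : ℕ) (C : Finset ℕ) (w : ℕ → ℝ)
    (E : OddSet n → Matrix (Fin r) (Fin r) ℝ) (Y : PMatch n → Matrix (Fin r) (Fin r) ℝ)
    (hY : ∀ M, (Y M).PosSemidef ∧ (1 - Y M).PosSemidef) :
    |∑ U, ∑ M, levelWeight n t C w U M * (E U * Y M).trace| ≤
      (∑ c ∈ C, |w c|) * Real.sqrt r *
        ((∑ U : OddSet n, if U.1.card = t then Real.sqrt (∑ a, ∑ b, E U a b ^ 2) else 0) /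
          ((univ.filter fun U : OddSet n => U.1.card = t).card : ℝ)) :=
  abs_value_le_frobenius_avg t C w (Real.sqrt_nonneg _) E Y fun M => Real.sqrt_le_sqrt (frobenius_sq_le (hY M).1 (hY M).2)

/-- **L¹-FROBENIUS SLACK (matching side).** For ANY matching field `E` and ANY cut field `X` with `‖X_U‖_F ≤ ρ`:
`|Σ_{U,M} W(U,M)·tr(X_U E_M)| ≤ (Σ_c|w_c|)·ρ·(Σ_M ‖E_M‖_F)/|PM|`. [cite: Rothvoss2017, §2 (PDF p. 6)] -/
theorem abs_value_le_frobenius_avg_matchingSide (t : ℕ) (C : Finset ℕ) (w : ℕ → ℝ) {ρ : ℝ} (hρ : 0 ≤ ρ)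
    (X : OddSet n → Matrix (Fin r) (Fin r) ℝ) (E : PMatch n → Matrix (Fin r) (Fin r) ℝ)
    (hX : ∀ U, Real.sqrt (∑ a, ∑ b, X U a b ^ 2) ≤ ρ) :
    |∑ U, ∑ M, levelWeight n t C w U M * (X U * E M).trace| ≤
      (∑ c ∈ C, |w c|) * ρ * ((∑ M : PMatch n, Real.sqrt (∑ a, ∑ b, E M a b ^ 2)) / (Fintype.card (PMatch n) : ℝ)) := by
  set nF : PMatch n → ℝ := fun M => Real.sqrt (∑ a, ∑ b, E M a b ^ 2) with hnF
  have hXE : ∀ U M, |(X U * E M).trace| ≤ ρ * nF M := fun U M =>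
    (abs_trace_mul_le_frobenius (X U) (E M)).trans (mul_le_mul_of_nonneg_right (hX U) (Real.sqrt_nonneg _))
  calc |∑ U, ∑ M, levelWeight n t C w U M * (X U * E M).trace|
      ≤ ∑ U, |∑ M, levelWeight n t C w U M * (X U * E M).trace| := abs_sum_le_sum_abs _ _
    _ ≤ ∑ U, ∑ M, |levelWeight n t C w U M * (X U * E M).trace| := sum_le_sum fun U _ => abs_sum_le_sum_abs _ _
    _ ≤ ∑ U, ∑ M, absWeight n t C w U M * (ρ * nF M) := by
        refine sum_le_sum fun U _ => sum_le_sum fun M _ => ?_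
        rw [abs_mul]
        exact mul_le_mul (abs_levelWeight_le_absWeight t C w U M) (hXE U M) (abs_nonneg _) (absWeight_nonneg t C w U M)
    _ = ∑ M, (∑ U, absWeight n t C w U M) * (ρ * nF M) := by
        rw [sum_comm]; exact sum_congr rfl fun M _ => by rw [sum_mul]
    _ ≤ ∑ M, (∑ c ∈ C, |w c|) / (Fintype.card (PMatch n) : ℝ) * (ρ * nF M) :=
        sum_le_sum fun M _ => mul_le_mul_of_nonneg_right (colSum_absWeight_le t C w M) (mul_nonneg hρ (Real.sqrt_nonneg _))
    _ = (∑ c ∈ C, |w c|) * ρ * ((∑ M : PMatch n, nF M) / (Fintype.card (PMatch n) : ℝ)) := by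
        have key : ∀ M : PMatch n, (∑ c ∈ C, |w c|) / (Fintype.card (PMatch n) : ℝ) * (ρ * nF M) =
            (∑ c ∈ C, |w c|) * ρ * (nF M / (Fintype.card (PMatch n) : ℝ)) := fun M => by ring
        simp_rw [key]
        rw [← Finset.mul_sum, ← Finset.sum_div]

/-! ### §2 The SIGN cell, modular form -/

/-- **THE SIGN CELL, MODULAR FORM: `X = A Aᵀ + H + E`.** For `n` even, an exact design `(n, t = 2c'+1, T, D ≤ 2c', B_v, C, w)`, `D ≤ k ≤ c'`, a
psd-contraction matching field `Y`, and ANY cut field written as `X = A Aᵀ + H + E` with `A` of Johnson degree `≤ k` and `A Aᵀ ⪯ I`, `H` high-pass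
(a harmonic datum `p` on the `t`-cuts vanishing up to degree `D`) and `E` arbitrary:
`value(X,Y) ≤ r·(B_v√P_D + 2^{k+1}√P_k + Σ_{κ∈(D/2,k/2]} R_κ√A_κ) + B_v·√(P_D·(N_H/C(n,t))·r) + B_v·√r·avg_{|U|=t}‖E_U‖_F`.
[cite: Grigoriev2001, Lemma 1.4 (PDF p. 8)] [cite: Rothvoss2017, §2 (PDF p. 6)] [cite: GriblingDelaatLaurent2019, §5] -/
theorem value_le_of_sign_highPass_frobenius {c' T D : ℕ} {Bv : ℝ} {C : Finset ℕ} {w : ℕ → ℝ} (hn : Even n)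
    (hdes : IsExactDesign n (2 * c' + 1) T D Bv C w) (hD : D ≤ 2 * c') {m k : ℕ} (hDk : D ≤ k) (hkc : k ≤ c')
    (A : OddSet n → Matrix (Fin r) (Fin m) ℝ) (hA : IsLowDegreeU n k A) (hA1 : ∀ U, (1 - A U * (A U)ᵀ).PosSemidef)
    (H E : OddSet n → Matrix (Fin r) (Fin r) ℝ)
    (p : Fin r × Fin r → ℕ → Finset (Fin n) → ℝ) (hp : ∀ ab j, IsHarmonic j (p ab j))
    (hdec : ∀ ab (U : OddSet n), U.1.card = 2 * c' + 1 →
      H U ab.1 ab.2 = (∑ j ∈ range (2 * c' + 1 + 1), up^[2 * c' + 1 - j] (p ab j)) U.1)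
    (hhigh : ∀ ab j, j ≤ D → p ab j = 0)
    (Y : PMatch n → Matrix (Fin r) (Fin r) ℝ) (hY : ∀ M, (Y M).PosSemidef ∧ (1 - Y M).PosSemidef) :
    ∑ U, ∑ M, levelWeight n (2 * c' + 1) C w U M * ((A U * (A U)ᵀ + H U + E U) * Y M).trace ≤
      (r : ℝ) * (Bv * Real.sqrt (∏ i ∈ range (D / 2 + 1), ((2 * i + 1 : ℝ) / ((n : ℝ) - 2 * i))) +
        2 ^ (k + 1) * Real.sqrt (∏ i ∈ range (k / 2 + 1), ((2 * i + 1 : ℝ) / ((n : ℝ) - 2 * i))) +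
        ∑ κ ∈ Ico (D / 2 + 1) (k / 2 + 1),
          (∏ i ∈ range κ, (((2 * c' + 1 : ℝ) - 2 * i) * ((n : ℝ) - 2 * c' - 1 - 2 * i) /
              (((2 * c' : ℝ) - 2 * i) * ((n : ℝ) - 2 * c' - 2 - 2 * i)))) *
            Real.sqrt (∏ i ∈ range κ, ((2 * i + 1 : ℝ) / ((n : ℝ) - 2 * i)))) +
      Bv * Real.sqrt ((∏ i ∈ range (D / 2 + 1), ((2 * i + 1 : ℝ) / ((n : ℝ) - 2 * i))) *
          ((∑ U : OddSet n, if U.1.card = 2 * c' + 1 then ∑ a, ∑ b, H U a b ^ 2 else 0) / (n.choose (2 * c' + 1) : ℝ)) * r) +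
      Bv * Real.sqrt r *
        ((∑ U : OddSet n, if U.1.card = 2 * c' + 1 then Real.sqrt (∑ a, ∑ b, E U a b ^ 2) else 0) /
          ((univ.filter fun U : OddSet n => U.1.card = 2 * c' + 1).card : ℝ)) := by
  have hBv : ∑ c ∈ C, |w c| ≤ Bv := hdes.2.2.2.2.2.2
  have hBv0 : 0 ≤ ∑ c ∈ C, |w c| := sum_nonneg fun c _ => abs_nonneg _
  have hPm : (0 : ℝ) < Fintype.card (PMatch n) := by
    exact_mod_cast Summit.PneNP.PneNP.Theorems.ChebyshevTracialDesignProfilePolynomial.card_pmatch_pos hn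
  -- split the value
  rw [value_add_left, value_add_left]
  -- (1) SIGN
  have h1 := value_le_of_lowDegree_allModes_sharp hn hdes hD hDk hkc A hA hA1 Y hY
  -- (2) high-pass
  have h2 := (abs_le.1 (abs_value_le_of_highPass hn hdes hD H Y p hp hdec hhigh)).2
  have hNY : (∑ M : PMatch n, ∑ a, ∑ b, Y M a b ^ 2) / (Fintype.card (PMatch n) : ℝ) ≤ r := by
    rw [div_le_iff₀ hPm]
    calc ∑ M : PMatch n, ∑ a, ∑ b, Y M a b ^ 2 ≤ ∑ _M : PMatch n, (r : ℝ) := sum_le_sum fun M _ => frobenius_sq_le (hY M).1 (hY M).2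
      _ = r * (Fintype.card (PMatch n) : ℝ) := by rw [sum_const, card_univ, nsmul_eq_mul, mul_comm]
  set PD : ℝ := ∏ i ∈ range (D / 2 + 1), ((2 * i + 1 : ℝ) / ((n : ℝ) - 2 * i)) with hPDdef
  set NH : ℝ := (∑ U : OddSet n, if U.1.card = 2 * c' + 1 then ∑ a, ∑ b, H U a b ^ 2 else 0) / (n.choose (2 * c' + 1) : ℝ) with hNHdef
  have hPD : 0 ≤ PD := Summit.PneNP.PneNP.Theorems.ChebyshevTracialDesignProfilePolynomial.prod_atten_nonneg (n := n) (K := D)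
    (by have := hdes.2.1; omega)
  have hNH : 0 ≤ NH := div_nonneg (sum_nonneg fun U _ => by split_ifs <;> [exact sum_nonneg fun a _ => sum_nonneg fun b _ => sq_nonneg _; exact le_rfl])
    (Nat.cast_nonneg _)
  have h2' : ∑ U, ∑ M, levelWeight n (2 * c' + 1) C w U M * (H U * Y M).trace ≤ Bv * Real.sqrt (PD * NH * r) := by
    refine h2.trans ?_
    calc (∑ c ∈ C, |w c|) * Real.sqrt (PD * NH * ((∑ M : PMatch n, ∑ a, ∑ b, Y M a b ^ 2) / (Fintype.card (PMatch n) : ℝ)))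
        ≤ (∑ c ∈ C, |w c|) * Real.sqrt (PD * NH * r) :=
          mul_le_mul_of_nonneg_left (Real.sqrt_le_sqrt (mul_le_mul_of_nonneg_left hNY (mul_nonneg hPD hNH))) hBv0
      _ ≤ Bv * Real.sqrt (PD * NH * r) := mul_le_mul_of_nonneg_right hBv (Real.sqrt_nonneg _)
  -- (3) Frobenius slack
  have h3 := (abs_le.1 (abs_value_le_frobenius_avg_contraction (2 * c' + 1) C w E Y hY)).2
  have havg0 : 0 ≤ (∑ U : OddSet n, if U.1.card = 2 * c' + 1 then Real.sqrt (∑ a, ∑ b, E U a b ^ 2) else 0) /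
      ((univ.filter fun U : OddSet n => U.1.card = 2 * c' + 1).card : ℝ) :=
    div_nonneg (sum_nonneg fun U _ => by split_ifs <;> [exact Real.sqrt_nonneg _; exact le_rfl]) (Nat.cast_nonneg _)
  have h3' : ∑ U, ∑ M, levelWeight n (2 * c' + 1) C w U M * (E U * Y M).trace ≤
      Bv * Real.sqrt r * ((∑ U : OddSet n, if U.1.card = 2 * c' + 1 then Real.sqrt (∑ a, ∑ b, E U a b ^ 2) else 0) /
        ((univ.filter fun U : OddSet n => U.1.card = 2 * c' + 1).card : ℝ)) :=
    h3.trans (mul_le_mul_of_nonneg_right (mul_le_mul_of_nonneg_right hBv (Real.sqrt_nonneg _)) havg0)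
  rw [hPDdef, hNHdef] at h2'
  linarith [h1, h2', h3']

end Summit.PneNP.PneNP.Theorems.ChebyshevTracialDesignFrobeniusSlack

end
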